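import Summits.BirchSwinnertonDyer.BirchSwinnertonDyer.Theorems.AdditiveBranchIMCGordTwoRankOneHeegnerKolyvaginSelfTwistHalves
import Summits.BirchSwinnertonDyer.BirchSwinnertonDyer.Theorems.AdditiveBranchIMCMultLowerCycLineTwistData
import Summits.BirchSwinnertonDyer.Rank1Residual.Additive.GordBranchMeetsField
import Summits.BirchSwinnertonDyer.Rank1Residual.Additive.SemistableTwistAnalytic
import Summits.BirchSwinnertonDyer.Rank1Residual.Additive.N10LowerHalfStatements
import Summits.BirchSwinnertonDyer.Rank1Residual.Partition.MainConjecturesAnticyclotomicClass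
import Summits.BirchSwinnertonDyer.Rank1Residual.GaloisImage.JWitnessTowerSurjectivity
import Literature.NumberTheory.EllipticCurves.Rank1Residual.Typed.WuthrichUpperBound
import Literature.NumberTheory.EllipticCurves.NonEisensteinPrimeOfSurjective
import Literature.NumberTheory.QuadraticFields.ImaginaryResiduePiForm
import HarnessLib

/-!
# Route `AdditiveBranchIMC` (rung K1), crux `GordTwoRankOne` (item 19358): the HEIGHT-FREE
# Heegner–Kolyvagin road — Part 21c: the SELF-TWIST FRAME on cell (G-ord, `e = 2`) — `K = ℚ(√−p)`,
# the GOOD ordinary `p*`-twist `V` parametrised, `E = V^{(d_K)}` the rank-one twist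
# (cell `bsd-addord`, second prover lane `bsd-addord-k1-c3x`, gen 5; `--supports 19358 --as helper` only)

HONEST FRAMING. THEOREMS ONLY: no definition, no new named fact, no `sorry`; nothing is booked; BSD is
not proved by any of this; the crux, STEP L′ (item 20498) and the sibling's crux 21398 stay OPEN at class
level. Lane A (`bsd-addord-k1-c3`) runs per-pair `A′` certificates; no overlap.

THE FRAME (gen 4's census row «`K = ℚ(√−p)` self-twist — NOT attempted: the Heegner hypothesis fails at
`p`» REPAIRED: it fails for `E`, not for the twist). On cell (G-ord, `e = 2`) the `p*`-twist `V` of `E`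
is GOOD ordinary at `p` (`TypeGOrd.exists_goodOrd_model_twist_pStar`) and `E ≅ Cd • V^{(p*)}`. When
`p ≡ 3 (mod 4)`, `p* = −p = d_K` for `K = ℚ(√−p)`: `E` is the quadratic twist of `V` BY THE HEEGNER
FIELD, `E_K ≅ V_K`, and the classical Heegner hypothesis is a condition on `(N_V, K)` = «every prime
`ℓ ≠ p` of `N_E` splits in `ℚ(√−p)`» (`p ∤ N_V = N_E/p²`). The additive prime of `E` has become (i) a GOOD
ORDINARY prime of the parametrised curve `V` and (ii) the RAMIFIED prime of `K`. Jetchev–Skinner–Wan's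
§7.4 then runs in the configuration of Kolyvagin's original theorem (`V` of analytic rank `0`, i.e.
`L(E^{(−p)},1) ≠ 0`; the twist `E` of rank `1`) through Parts 21a/21b (p573821, p574812), and the typed
inputs of lane B transpose VERBATIM because, AS PRINTED, neither Gross–Zagier (Cai–Shu–Tian 2014 Thm.
1.1: any fundamental `d_K`), nor Kolyvagin 1990 Thm. A / McCallum 1991 (§3, p. 299: «`K` imaginary
quadratic, `p` odd, `Gal(ℚ(E_p)/ℚ) = GL₂`» — read this gen), nor Wuthrich 2014 Prop. 21, nor Mazur 1978
Cor. 4.1 (at the GOOD prime `p ∤ N_V` of `V`) carries a hypothesis `p ∤ d_K`. (W. Zhang 2014 Thm. 1.1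
DOES — «`p ∤ D_K N`», p. 195 — so Kolyvagin's conjecture for `(V, ℚ(√−p))` is NOT in print: recorded,
not used.)

* §3 `missingLowerBoundAt_of_selfTwistFrame[_of_wuthrich]` (pointwise, frame explicit) and
  `cellGordTwo_missingLowerBoundAt_rankOne_of_selfTwistIndexBound` (CLASS level): on the rows `p ≥ 5`,
  `p ≡ 3 (mod 4)`, `ρ̄_{E,p}` onto, every `ℓ ∣ N_E`, `ℓ ≠ p` split in `ℚ(√−p)`, `L(E^{(−p)},1) ≠ 0`:
  LOWER(E,p) ⟸ PUBLISHED facts by name + ONE typed input, the JSW inequality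
  `2·v_p[V(K):ℤP] ≤ v_p #Ш(V/K) + v_p ∏c(V) + v_p ∏c(E)` for the GOOD ORDINARY curve `V` over `ℚ(√−p)`
  (the shape of item 20498 with curve and twist exchanged). NO additive prime, NO Λ-adic object on a
  twisted branch, NO `p`-adic height, NO Manin rider (Mazur at a good prime), NO Tamagawa condition.
* §4 `bsdp_of_selfTwistFrame` (pointwise): `BSD(E,p)` ⟸ the same inequality + `BSD(V,p)` (rank `0`, good
  ordinary: BCS 2025 Cor. 1.3.1 via `bsdp_twist_pStar_of_classX4_of_surj`, PUB*; or Skinner 2016 Thm. C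
  under (ram), flag-free) + Kolyvagin 1990 for `(V, K)` + `p ∤ ∏c(V)∏c(E)`.

WHAT THE OPEN INPUT BECOMES on these rows: JSW 2017 (eq:shalower) for a GOOD ORDINARY curve over an
imaginary quadratic field in which `p` RAMIFIES (JSW / BDP / Wan need `p` split; Andreatta–Iovita 2024
give a BDP formula at non-split `p`; the Selmer-large anticyclotomic divisibility at a RAMIFIED `p` is in
print for no non-CM form — for CM curves it is Burungale–Kobayashi–Nakamura–Ota 2026 Thm. 1.7, PRE): the
README row B13 object read at a non-CM curve, instead of a twisted-branch object at an additive prime. Per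
pair it is decided by ONE McCallum certificate for `(V, K)` (lane B Part 3's door, unchanged: McCallum's
fact has no `p ∤ d_K` either). MASS: the sub-row is thin (`p ≡ 3 (mod 4)` only: `p = 3` is excluded by
`#𝓞_{ℚ(√−3)}^× = 6`, `p = 5` by `5 ≡ 1`; first prime `p = 7`) — a structural door, not a booking device.

References: [JetchevSkinnerWan2017] §7.4.1; [GrossZagier1986] I.§3, V.§2; [CaiShuTian2014] Thm. 1.1;
[McCallumLMS1991] §1, §3 (p. 299); [KolyvaginEulerSystems1990] Thm. A; [Wuthrich2014] Prop. 21;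
[Mazur1978] Cor. 4.1; [WZhang2014] Thm. 1.1 (p. 195); [AndreattaIovita2024];
[BurungaleKobayashiNakamuraOta2026] Thm. 1.7; [SilvermanAEC2009] VII.1 Prop. 1.3(b), X.5 Cor. 5.4;
[Miller2011LMS] Def. 1.1.
-/

set_option autoImplicit false
set_option linter.dupNamespace false
noncomputable section

open scoped Classical NumberField
open WeierstrassCurve NumberField IsDedekindDomain
  Literature.NumberTheory.EllipticCurves Literature.NumberTheory.EllipticCurves.ModularForms
  Literature.NumberTheory.EllipticCurves.Rank1Residual
  Literature.NumberTheory.EllipticCurves.Rank1Residual.Typed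
  Summit.BirchSwinnertonDyer.Rank1Residual
  Summit.BirchSwinnertonDyer.Rank1Residual.Additive

namespace Summit.BirchSwinnertonDyer.BirchSwinnertonDyer.Theorems.AdditiveBranchIMCGordTwoRankOne.HeegnerKolyvagin

/-! ### §3 The self-twist frame on cell (G-ord, `e = 2`): `K = ℚ(√−p)`, the `p*`-twist `V` parametrised -/

/-- **`ord_p u(Cd) = 0` for the model change from `V^{(d_K)}` to `E` when `d_K = ±p` and `V` is GOOD at `p`**
(`V`, `E` globally minimal; `p` odd): both `V^{(±p)}` (`ord_p Δ = 6 < 12`) and `E` are `p`-minimal — the tree's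
`padicValRat_u_eq_zero_of_twist_pm_p_of_lt_six` with `ord_p Δ_min(V) = 0 < 6`. [cite: SilvermanAEC2009, VII.1 Prop. 1.3(b) and Remark 1.1] -/
theorem padicValRat_u_eq_zero_of_good_of_twist_discr_eq_neg
    (V W : WeierstrassCurve ℚ) [V.IsElliptic] [V.IsGloballyMinimal] [W.IsGloballyMinimal] (p : ℕ) [Fact p.Prime]
    (hp2 : p ≠ 2) (hVgood : V.HasGoodReductionAtPrime p) (K : Type) [Field K] [NumberField K]
    (hdisc : NumberField.discr K = -(p : ℤ)) (Cd : VariableChange ℚ)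
    (hCd : Cd • V.quadraticTwist (NumberField.discr K : ℚ) = W) : padicValRat p (Cd.u : ℚ) = 0 := by
  have hV : padicValInt p V.minimalDiscriminantInt < 6 := by
    rw [padicValInt.eq_zero_of_not_dvd (V.not_dvd_minimalDiscriminantInt_of_hasGoodReductionAtPrime' p hVgood)]
    norm_num
  exact padicValRat_u_eq_zero_of_twist_pm_p_of_lt_six p hp2 V W hV (d := NumberField.discr K) (Or.inr hdisc) Cd hCd

/-- **THE POINTWISE LOWER HALF ON THE SELF-TWIST FRAME.** Data: `V/ℚ` globally minimal, GOOD at the odd prime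
`p`, with `L(V,1) ≠ 0` and the rank-zero UPPER half `hUV : MissingUpperBoundAt V p` (in print: Wuthrich 2014
Prop. 21 — `missingLowerBoundAt_of_selfTwistFrame_of_wuthrich` below discharges it for Borel-or-surjective image);
`K` imaginary quadratic with `d_K = −p` (so `p ≡ 3 (mod 4)`, `K = ℚ(√−p)`, `p` RAMIFIED in `K`), `p ∤ #𝓞_K^×`, and
the Heegner hypothesis for `N_V` (`p ∤ N_V`); `E = W = Cd • V^{(d_K)}` a globally minimal model of the twist
BY THE HEEGNER FIELD with `ord_{s=1} L(E,s) = 1` — on cell (G-ord, `e = 2`) this is the given additive curve and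
`V` its good ordinary `p*`-twist; `P ∈ V(K)` the Heegner point of a datum `Dt` of `V` with `p ∤ c(Dt)`.
PUBLISHED binders `hGZ`, `hKo` (for `(N_V, V, K)`), `hGZK`, `hmod`. THE ONE TYPED INPUT `hL`: the JSW inequality
`2·v_p[V(K):ℤP] ≤ v_p #Ш(V/K) + v_p ∏c(V) + v_p ∏c(E)` for the GOOD ORDINARY curve `V` over `ℚ(√−p)` (the shape
of item 20498 with the roles of curve and twist exchanged). CONCLUSION: `Typed.MissingLowerBoundAt W p` — the
LOWER half of `BSD(E,p)` at the ADDITIVE prime `p` of `E`, with no additive prime, no Λ-adic object and no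
height anywhere in the hypotheses. [cite: JetchevSkinnerWan2017, §7.4.1 (eq:shalower), pp. 30–31]
[cite: GrossZagier1986, V.§2] [cite: SilvermanAEC2009, X.5 Cor. 5.4] [cite: Miller2011LMS, Def. 1.1] -/
theorem missingLowerBoundAt_of_selfTwistFrame
    (hGZK : rank_eq_analyticRank_of_analyticRank_le_one) (hmod : hasEntireLFunction_rat)
    (W : WeierstrassCurve ℚ) [W.IsElliptic] [W.IsGloballyMinimal] (p : ℕ) [Fact p.Prime] (hp2 : p ≠ 2)
    (hr : W.analyticRank = 1)
    (V : WeierstrassCurve ℚ) [V.IsElliptic] [V.IsGloballyMinimal] (N : ℕ) [NeZero N]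
    (K : Type) [Field K] [NumberField K] (hK : IsImaginaryQuadratic K)
    (hdisc : NumberField.discr K = -(p : ℤ)) (hμ : ¬ p ∣ Units.torsionOrder K)
    (Cd : VariableChange ℚ) (hCd : Cd • V.quadraticTwist (NumberField.discr K : ℚ) = W)
    (hVgood : V.HasGoodReductionAtPrime p) (hLV : V.entireLFunction 1 ≠ 0) (hUV : Typed.MissingUpperBoundAt V p)
    (hHN : SatisfiesHeegnerHypothesis N K) (hGZ : gross_zagier N V K) (hKo : kolyvagin N V K)
    (Dt : ModularParametrizationData V N) (H : HeegnerDatum N (NumberField.discr K)) (ι : K →+* ℂ)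
    (P : (V.baseChange K).toAffine.Point)
    (hP : WeierstrassCurve.Affine.Point.map ι.toRatAlgHom P = heegnerPointComplex Dt H) (hc : ¬ (p : ℤ) ∣ Dt.c)
    (hL : Finite (V.baseChange K).sha →
      (2 * padicValNat p (AddSubgroup.zmultiples P).index : ℤ) ≤
        padicValNat p (V.baseChange K).shaOrder + padicValNat p V.tamagawaProduct +
          padicValNat p W.tamagawaProduct) :
    Typed.MissingLowerBoundAt W p := by
  have hr0 : V.analyticRank = 0 := (V.analyticRank_eq_zero_iff_holds (hmod V)).2 hLV
  have hu : padicValRat p (Cd.u : ℚ) = 0 :=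
    padicValRat_u_eq_zero_of_good_of_twist_discr_eq_neg V W p hp2 hVgood K hdisc Cd hCd
  exact missingLowerBoundAt_twist_of_upper_of_indexBound V p N K Dt H ι P hGZ hKo hGZK hmod hK hHN hP hp2 hc hμ
    hr0 hUV W Cd hCd hu hr hL

/-- **The same with UPPER(V) discharged by Wuthrich 2014 Prop. 21** (`hW21 : sha_dvd_analyticSha`, PUBLISHED:
`p` odd, `V` GOOD at `p` — not additive —, `ρ̄_{V,p}` Borel or onto; tree theorem
`Typed.missingUpperBoundAt_of_wuthrich`). On the frame the image hypothesis is read on `E` (`E[p] ≅ V[p] ⊗ χ_{d_K}`: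
`hasSurjectiveModNGaloisRep_pow_iff_of_model_twist`). [cite: Wuthrich2014, Prop. 21 (p. 400)]
[cite: JetchevSkinnerWan2017, §7.4.1 (eq:shalower), pp. 30–31] -/
theorem missingLowerBoundAt_of_selfTwistFrame_of_wuthrich
    (hGZK : rank_eq_analyticRank_of_analyticRank_le_one) (hmod : hasEntireLFunction_rat)
    (hW21 : Wuthrich2014.sha_dvd_analyticSha)
    (W : WeierstrassCurve ℚ) [W.IsElliptic] [W.IsGloballyMinimal] (p : ℕ) [Fact p.Prime] (hp2 : p ≠ 2)
    (hr : W.analyticRank = 1) (hsurj : W.HasSurjectiveModNGaloisRep p)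
    (V : WeierstrassCurve ℚ) [V.IsElliptic] [V.IsGloballyMinimal] (N : ℕ) [NeZero N]
    (K : Type) [Field K] [NumberField K] (hK : IsImaginaryQuadratic K)
    (hdisc : NumberField.discr K = -(p : ℤ)) (hμ : ¬ p ∣ Units.torsionOrder K)
    (Cd : VariableChange ℚ) (hCd : Cd • V.quadraticTwist (NumberField.discr K : ℚ) = W)
    (hVgood : V.HasGoodReductionAtPrime p) (hLV : V.entireLFunction 1 ≠ 0)
    (hHN : SatisfiesHeegnerHypothesis N K) (hGZ : gross_zagier N V K) (hKo : kolyvagin N V K)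
    (Dt : ModularParametrizationData V N) (H : HeegnerDatum N (NumberField.discr K)) (ι : K →+* ℂ)
    (P : (V.baseChange K).toAffine.Point)
    (hP : WeierstrassCurve.Affine.Point.map ι.toRatAlgHom P = heegnerPointComplex Dt H) (hc : ¬ (p : ℤ) ∣ Dt.c)
    (hL : Finite (V.baseChange K).sha →
      (2 * padicValNat p (AddSubgroup.zmultiples P).index : ℤ) ≤
        padicValNat p (V.baseChange K).shaOrder + padicValNat p V.tamagawaProduct +
          padicValNat p W.tamagawaProduct) :
    Typed.MissingLowerBoundAt W p := by
  have hr0 : V.analyticRank = 0 := (V.analyticRank_eq_zero_iff_holds (hmod V)).2 hLV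
  have hD0 : (NumberField.discr K : ℚ) ≠ 0 := by exact_mod_cast NumberField.discr_ne_zero K
  have hsurjV : V.HasSurjectiveModNGaloisRep p := by
    have h := (GaloisImage.hasSurjectiveModNGaloisRep_pow_iff_of_model_twist V p hD0 ⟨Cd, hCd⟩ 1)
    rw [pow_one] at h
    exact h.mp hsurj
  have hUV : Typed.MissingUpperBoundAt V p :=
    Typed.missingUpperBoundAt_of_wuthrich V p hW21 hGZK hmod hp2 hr0
      (WeierstrassCurve.HasGoodReduction.not_hasAdditiveReduction (R := ℤ_[p]) hVgood) (Or.inr hsurjV)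
  exact missingLowerBoundAt_of_selfTwistFrame hGZK hmod W p hp2 hr V N K hK hdisc hμ Cd hCd hVgood hLV hUV hHN hGZ
    hKo Dt H ι P hP hc hL

/-- **CELL LEVEL: the LOWER half of `BSD(E,p)` on the self-twist rows of cell (G-ord, `e = 2`).** For every
globally minimal `E/ℚ` with `ord_{s=1}L(E,s) = 1` and every pair of the cell with `p ≥ 5`, `p ≡ 3 (mod 4)`,
`ρ̄_{E,p}` onto, such that — with `K = ℚ(√−p)` (any imaginary quadratic `K` with `d_K = −p`) — every prime
`ℓ ≠ p` of the conductor of `E` SPLITS in `K` (the classical Heegner hypothesis for `N_E/p²`) and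
`L(E^{(−p)},1) ≠ 0`: `Typed.MissingLowerBoundAt W p`, GIVEN the PUBLISHED facts by name (Gross–Zagier,
Kolyvagin qualitative, GZK, modularity, Wuthrich 2014 Prop. 21, newforms, Mazur 1978 Cor. 4.1, Néron scaling) and
the ONE typed input `hL`: the JSW inequality for the GOOD ORDINARY `p*`-twist `V` over `K` at every Manin-good
Heegner frame. Assembly: `V` by `TypeGOrd.exists_goodOrd_model_twist_pStar` (good at `p`, `E ≅ Cd • V^{(−p)}`,
`(−1)^{(p−1)/2} = −1`); the Heegner hypothesis for `N_V` from the row (`ℓ ∣ N_V ⇒ ℓ ∣ N_E`, `p ∤ N_V`);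
`ρ̄_{V,p}` onto hence irreducible; `#𝓞_K^× = 2`; the frame with `p ∤ c` by `X11b.exists_maninDatum_of_good`
(Mazur at the GOOD prime `p` of `V`); then `missingLowerBoundAt_of_selfTwistFrame_of_wuthrich`.
[cite: JetchevSkinnerWan2017, §7.4.1 (eq:shalower), pp. 30–31] [cite: Mazur1978, Cor. 4.1]
[cite: Wuthrich2014, Prop. 21 (p. 400)] [cite: GrossZagier1986, I.§3 (Heegner hypothesis) and V.§2] -/
theorem cellGordTwo_missingLowerBoundAt_rankOne_of_selfTwistIndexBound
    (hGZ : ∀ (N : ℕ) [NeZero N] (V : WeierstrassCurve ℚ) (K : Type) [Field K] [NumberField K], gross_zagier N V K)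
    (hKo : ∀ (N : ℕ) [NeZero N] (V : WeierstrassCurve ℚ) (K : Type) [Field K] [NumberField K], kolyvagin N V K)
    (hGZK : rank_eq_analyticRank_of_analyticRank_le_one) (hmod : hasEntireLFunction_rat)
    (hW21 : Wuthrich2014.sha_dvd_analyticSha) (hnf : exists_isNewformOf)
    (hMaz : mazur_not_dvd_maninConstant_of_odd) (hNS : integral_neronScaling_of_isGloballyMinimal)
    (hL : ∀ (V : WeierstrassCurve ℚ) [V.IsElliptic] [V.IsGloballyMinimal] (p : ℕ) [Fact p.Prime]
      [NeZero (V.conductorNorm ℤ)] (K : Type) [Field K] [NumberField K]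
      (W : WeierstrassCurve ℚ) [W.IsElliptic] [W.IsGloballyMinimal] (Cd : VariableChange ℚ)
      (Dt : ModularParametrizationData V (V.conductorNorm ℤ)) (H : HeegnerDatum (V.conductorNorm ℤ) (NumberField.discr K))
      (ι : K →+* ℂ) (P : (V.baseChange K).toAffine.Point),
      V.HasGoodReductionAtPrime p → V.entireLFunction 1 ≠ 0 → V.HasSurjectiveModNGaloisRep p →
      IsImaginaryQuadratic K → NumberField.discr K = -(p : ℤ) → SatisfiesHeegnerHypothesis (V.conductorNorm ℤ) K →
      Cd • V.quadraticTwist (NumberField.discr K : ℚ) = W → W.analyticRank = 1 → N10.CellGordTwo W p →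
      WeierstrassCurve.Affine.Point.map ι.toRatAlgHom P = heegnerPointComplex Dt H → ¬ (p : ℤ) ∣ Dt.c →
      Finite (V.baseChange K).sha →
      (2 * padicValNat p (AddSubgroup.zmultiples P).index : ℤ) ≤
        padicValNat p (V.baseChange K).shaOrder + padicValNat p V.tamagawaProduct + padicValNat p W.tamagawaProduct) :
    ∀ (W : WeierstrassCurve ℚ) [W.IsElliptic] [W.IsGloballyMinimal] (p : ℕ) [Fact p.Prime]
      (K : Type) [Field K] [NumberField K],
      W.analyticRank = 1 → N10.CellGordTwo W p → 5 ≤ p → p % 4 = 3 → W.HasSurjectiveModNGaloisRep p →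
      IsImaginaryQuadratic K → NumberField.discr K = -(p : ℤ) →
      (∀ ℓ : ℕ, ℓ.Prime → (ℓ : ℤ) ∣ ↑(W.conductorNorm ℤ) → ℓ ≠ p →
        ((Ideal.span {(ℓ : ℤ)}).primesOver (𝓞 K)).ncard = 2) →
      (W.quadraticTwist (-(p : ℚ))).entireLFunction 1 ≠ 0 →
      Typed.MissingLowerBoundAt W p := by
  intro W _ _ p _ K _ _ hr hc2 hp5 hp4 hsurj hK hdisc hHeeg hLt
  have hp : p.Prime := Fact.out
  obtain ⟨hp2, hadd, hG, he⟩ := hc2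
  -- the good ordinary `p*`-twist `V`, `p* = −p = d_K`
  obtain ⟨V, _, _, ⟨C, hC⟩, hord⟩ := TypeGOrd.exists_goodOrd_model_twist_pStar W p hp2 hG hadd he
  have hVgood : V.HasGoodReductionAtPrime p := hord.1
  have hodd : Odd (p / 2) := ⟨p / 4, by omega⟩
  have hps : ((-1 : ℚ) ^ (p / 2) * p) = (NumberField.discr K : ℚ) := by
    rw [hodd.neg_one_pow, hdisc]; push_cast; ring
  have hD0 : (NumberField.discr K : ℚ) ≠ 0 := by exact_mod_cast NumberField.discr_ne_zero K
  have hC' : C • W.quadraticTwist (NumberField.discr K : ℚ) = V := by rw [← hps]; exact hC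
  obtain ⟨Cd, hCd⟩ := exists_variableChange_quadraticTwist_symm V W hD0 ⟨C, hC'⟩
  have hCd' : Cd • V.quadraticTwist ((-1 : ℚ) ^ (p / 2) * p) = W := by rw [hps]; exact hCd
  haveI : NeZero (V.conductorNorm ℤ) := ⟨(V.conductorNorm_pos_holds).ne'⟩
  -- the Heegner hypothesis for `N_V`
  have hHN : SatisfiesHeegnerHypothesis (V.conductorNorm ℤ) K := by
    intro ℓ hℓ hℓV
    have hℓV' : ℓ ∣ V.conductorNorm ℤ := by exact_mod_cast hℓV
    have hℓW : ℓ ∣ W.conductorNorm ℤ :=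
      AdditiveBranchIMCMultLower.dvd_conductorNorm_of_dvd_conductorNorm_twist_model hp2 V W Cd hCd' hadd hℓ hℓV'
    have hℓp : ℓ ≠ p := by
      rintro rfl
      exact (V.dvd_conductorNorm_iff_not_hasGoodReductionAtPrime ℓ).mp hℓV' hVgood
    exact hHeeg ℓ hℓ (by exact_mod_cast hℓW) hℓp
  -- the image of `V`
  have hsurjV : V.HasSurjectiveModNGaloisRep p := by
    have h := (GaloisImage.hasSurjectiveModNGaloisRep_pow_iff_of_model_twist V p hD0 ⟨Cd, hCd⟩ 1)
    rw [pow_one] at h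
    exact h.mp hsurj
  haveI : NeZero (p : ℚ) := ⟨by exact_mod_cast hp.ne_zero⟩
  have hirrV : V.HasIrreducibleModPGaloisRep p := hasIrreducibleModPGaloisRep_of_hasSurjectiveModNGaloisRep V p hsurjV
  -- `L(V,1) ≠ 0`
  have hLV : V.entireLFunction 1 ≠ 0 := by
    haveI : (W.quadraticTwist (NumberField.discr K : ℚ)).IsElliptic := W.isElliptic_quadraticTwist hD0
    have hVL : V.entireLFunction = (W.quadraticTwist (NumberField.discr K : ℚ)).entireLFunction := by
      rw [← hC', entireLFunction_smul]
    have hdq : (NumberField.discr K : ℚ) = -(p : ℚ) := by rw [hdisc]; push_cast; ring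
    rw [hVL, hdq]; exact hLt
  -- `#𝓞_K^× = 2`
  have hμ : ¬ p ∣ Units.torsionOrder K := by
    rw [Literature.NumberTheory.QuadraticFields.Quadratic.torsionOrder_eq_two_of_discr_lt_neg_four hK.1
      (by rw [hdisc]; omega)]
    intro h
    exact hp2 ((Nat.prime_dvd_prime_iff_eq hp Nat.prime_two).mp h)
  -- the Manin-good Heegner frame of `V` over `K`
  obtain ⟨Dt, H, ι, P, hP, hc⟩ :=
    X11b.exists_maninDatum_of_good hnf hMaz hNS V p (V.conductorNorm ℤ) K rfl hp2 hVgood hirrV hK hHN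
  exact missingLowerBoundAt_of_selfTwistFrame_of_wuthrich hGZK hmod hW21 W p hp2 hr hsurj V (V.conductorNorm ℤ) K hK
    hdisc hμ Cd hCd hVgood hLV hHN (hGZ _ V K) (hKo _ V K) Dt H ι P hP hc
    (hL V p K W Cd Dt H ι P hVgood hLV hsurjV hK hdisc hHN hCd hr ⟨hp2, hadd, hG, he⟩ hP hc)


/-! ### §4 Both halves on the frame: `BSD(E,p)` from the JSW inequality for `(V, ℚ(√−p))`, `BSD(V,p)`, Kolyvagin -/

/-- **`BSD(E,p)` ON THE SELF-TWIST FRAME** (both halves, JSW shape). Data as in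
`missingLowerBoundAt_of_selfTwistFrame`, plus: `ρ̄_{E,p}` onto (read on `V` for Kolyvagin's bound over `K` —
`E[p] ≅ V[p] ⊗ χ_{d_K}`), `BSD(V,p)` for the GOOD ordinary rank-zero `p*`-twist (`hBSDV`; in the tree:
Burungale–Castella–Skinner 2025 Cor. 1.3.1 via `bsdp_twist_pStar_of_classX4_of_surj` at `p ≥ 5` — PUB* flag —,
or Skinner 2016 Thm. C flag-free via `bsdp_goodOrd_rankZero_of_irr_of_ram` under (ram)), Kolyvagin 1990 Thm. A
for `(V, K)` (`hKB`, AS PRINTED: no `p ∤ d_K`), and `p ∤ ∏c(V)·∏c(E)`. CONCLUSION: `BSDp W p` ⟸ the JSW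
inequality `hL` for `(V, ℚ(√−p))`. [cite: JetchevSkinnerWan2017, §7.4 (pp. 29–31)]
[cite: McCallumLMS1991, §1 Theorem (Kolyvagin), p. 296] [cite: Miller2011LMS, Def. 1.1] -/
theorem bsdp_of_selfTwistFrame
    (hGZK : rank_eq_analyticRank_of_analyticRank_le_one) (hmod : hasEntireLFunction_rat)
    (W : WeierstrassCurve ℚ) [W.IsElliptic] [W.IsGloballyMinimal] (p : ℕ) [Fact p.Prime] (hp2 : p ≠ 2)
    (hr : W.analyticRank = 1) (hsurj : W.HasSurjectiveModNGaloisRep p)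
    (V : WeierstrassCurve ℚ) [V.IsElliptic] [V.IsGloballyMinimal] (N : ℕ) [NeZero N]
    (K : Type) [Field K] [NumberField K] (hK : IsImaginaryQuadratic K)
    (hdisc : NumberField.discr K = -(p : ℤ)) (hμ : ¬ p ∣ Units.torsionOrder K)
    (Cd : VariableChange ℚ) (hCd : Cd • V.quadraticTwist (NumberField.discr K : ℚ) = W)
    (hVgood : V.HasGoodReductionAtPrime p) (hLV : V.entireLFunction 1 ≠ 0) (hBSDV : BSDp V p)
    (hHN : SatisfiesHeegnerHypothesis N K) (hGZ : gross_zagier N V K) (hKo : kolyvagin N V K)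
    (hKB : Kolyvagin1990_padicValNat_card_sha_le N V K)
    (Dt : ModularParametrizationData V N) (H : HeegnerDatum N (NumberField.discr K)) (ι : K →+* ℂ)
    (P : (V.baseChange K).toAffine.Point)
    (hP : WeierstrassCurve.Affine.Point.map ι.toRatAlgHom P = heegnerPointComplex Dt H) (hc : ¬ (p : ℤ) ∣ Dt.c)
    (htamV : ¬ p ∣ V.tamagawaProduct) (htamW : ¬ p ∣ W.tamagawaProduct)
    (hL : Finite (V.baseChange K).sha →
      (2 * padicValNat p (AddSubgroup.zmultiples P).index : ℤ) ≤
        padicValNat p (V.baseChange K).shaOrder + padicValNat p V.tamagawaProduct +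
          padicValNat p W.tamagawaProduct) :
    BSDp W p := by
  have hr0 : V.analyticRank = 0 := (V.analyticRank_eq_zero_iff_holds (hmod V)).2 hLV
  have hD0 : (NumberField.discr K : ℚ) ≠ 0 := by exact_mod_cast NumberField.discr_ne_zero K
  have hu : padicValRat p (Cd.u : ℚ) = 0 :=
    padicValRat_u_eq_zero_of_good_of_twist_discr_eq_neg V W p hp2 hVgood K hdisc Cd hCd
  have hsurjV : V.HasSurjectiveModNGaloisRep p := by
    have h := (GaloisImage.hasSurjectiveModNGaloisRep_pow_iff_of_model_twist V p hD0 ⟨Cd, hCd⟩ 1)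
    rw [pow_one] at h
    exact h.mp hsurj
  haveI : Finite V.sha := (hGZK V (by omega)).2
  obtain ⟨hLV0, hUV⟩ := Typed.lower_and_upper_of_missingPPartAt V p (Typed.missingPPartAt_of_bsdp V p hBSDV)
  exact bsdp_twist_of_indexBound_of_halves V p N K Dt H ι P hGZ hKo hKB hGZK hmod hK hHN hP hp2 hc hμ hsurjV hr0
    hLV0 hUV W Cd hCd hu hr htamV htamW hL


/-! ### §4b REPAIR of §3's class theorem: the `p ≥ 5` restriction INSIDE the ∀-input (non-idle form) -/

/-- **CELL LEVEL, `p ≥ 5` INSIDE THE INPUT** — the non-idle form of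
`cellGordTwo_missingLowerBoundAt_rankOne_of_selfTwistIndexBound`. The ∀-input `hL` of that theorem ranges over
`p = 3` frames too (`d_K = −3`, `#𝓞_K^× = 6`), where by Part 22a's identity the unit-free inequality fails by `2` under
`BSD(E,3) ∧ BSD(V,3)` — so as a class statement it is vacuous (SELF-CORRECTION, gen 5). Here `hL5` carries `5 ≤ p` as
its FIRST propositional hypothesis (then `#𝓞_K^× = 2` and the inequality is BSD-consistent with equality; the uniform
alternative with the unit term is Part 22b's `…_of_selfTwistIndexBoundUnits`). Same rows, same published binders,
same proof. [cite: JetchevSkinnerWan2017, §7.4.1 (eq:shalower), pp. 30–31] [cite: GrossZagier1986, I.(6.5)]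
[cite: Mazur1978, Cor. 4.1] [cite: Wuthrich2014, Prop. 21 (p. 400)] -/
theorem cellGordTwo_missingLowerBoundAt_rankOne_of_selfTwistIndexBoundFive
    (hGZ : ∀ (N : ℕ) [NeZero N] (V : WeierstrassCurve ℚ) (K : Type) [Field K] [NumberField K], gross_zagier N V K)
    (hKo : ∀ (N : ℕ) [NeZero N] (V : WeierstrassCurve ℚ) (K : Type) [Field K] [NumberField K], kolyvagin N V K)
    (hGZK : rank_eq_analyticRank_of_analyticRank_le_one) (hmod : hasEntireLFunction_rat)
    (hW21 : Wuthrich2014.sha_dvd_analyticSha) (hnf : exists_isNewformOf)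
    (hMaz : mazur_not_dvd_maninConstant_of_odd) (hNS : integral_neronScaling_of_isGloballyMinimal)
    (hL5 : ∀ (V : WeierstrassCurve ℚ) [V.IsElliptic] [V.IsGloballyMinimal] (p : ℕ) [Fact p.Prime]
      [NeZero (V.conductorNorm ℤ)] (K : Type) [Field K] [NumberField K]
      (W : WeierstrassCurve ℚ) [W.IsElliptic] [W.IsGloballyMinimal] (Cd : VariableChange ℚ)
      (Dt : ModularParametrizationData V (V.conductorNorm ℤ)) (H : HeegnerDatum (V.conductorNorm ℤ) (NumberField.discr K))
      (ι : K →+* ℂ) (P : (V.baseChange K).toAffine.Point),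
      5 ≤ p → V.HasGoodReductionAtPrime p → V.entireLFunction 1 ≠ 0 → V.HasSurjectiveModNGaloisRep p →
      IsImaginaryQuadratic K → NumberField.discr K = -(p : ℤ) → SatisfiesHeegnerHypothesis (V.conductorNorm ℤ) K →
      Cd • V.quadraticTwist (NumberField.discr K : ℚ) = W → W.analyticRank = 1 → N10.CellGordTwo W p →
      WeierstrassCurve.Affine.Point.map ι.toRatAlgHom P = heegnerPointComplex Dt H → ¬ (p : ℤ) ∣ Dt.c →
      Finite (V.baseChange K).sha →
      (2 * padicValNat p (AddSubgroup.zmultiples P).index : ℤ) ≤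
        padicValNat p (V.baseChange K).shaOrder + padicValNat p V.tamagawaProduct + padicValNat p W.tamagawaProduct) :
    ∀ (W : WeierstrassCurve ℚ) [W.IsElliptic] [W.IsGloballyMinimal] (p : ℕ) [Fact p.Prime]
      (K : Type) [Field K] [NumberField K],
      W.analyticRank = 1 → N10.CellGordTwo W p → 5 ≤ p → p % 4 = 3 → W.HasSurjectiveModNGaloisRep p →
      IsImaginaryQuadratic K → NumberField.discr K = -(p : ℤ) →
      (∀ ℓ : ℕ, ℓ.Prime → (ℓ : ℤ) ∣ ↑(W.conductorNorm ℤ) → ℓ ≠ p →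
        ((Ideal.span {(ℓ : ℤ)}).primesOver (𝓞 K)).ncard = 2) →
      (W.quadraticTwist (-(p : ℚ))).entireLFunction 1 ≠ 0 →
      Typed.MissingLowerBoundAt W p := by
  intro W _ _ p _ K _ _ hr hc2 hp5 hp4 hsurj hK hdisc hHeeg hLt
  have hp : p.Prime := Fact.out
  obtain ⟨hp2, hadd, hG, he⟩ := hc2
  obtain ⟨V, _, _, ⟨C, hC⟩, hord⟩ := TypeGOrd.exists_goodOrd_model_twist_pStar W p hp2 hG hadd he
  have hVgood : V.HasGoodReductionAtPrime p := hord.1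
  have hodd : Odd (p / 2) := ⟨p / 4, by omega⟩
  have hps : ((-1 : ℚ) ^ (p / 2) * p) = (NumberField.discr K : ℚ) := by
    rw [hodd.neg_one_pow, hdisc]; push_cast; ring
  have hD0 : (NumberField.discr K : ℚ) ≠ 0 := by exact_mod_cast NumberField.discr_ne_zero K
  have hC' : C • W.quadraticTwist (NumberField.discr K : ℚ) = V := by rw [← hps]; exact hC
  obtain ⟨Cd, hCd⟩ := exists_variableChange_quadraticTwist_symm V W hD0 ⟨C, hC'⟩
  have hCd' : Cd • V.quadraticTwist ((-1 : ℚ) ^ (p / 2) * p) = W := by rw [hps]; exact hCd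
  haveI : NeZero (V.conductorNorm ℤ) := ⟨(V.conductorNorm_pos_holds).ne'⟩
  have hHN : SatisfiesHeegnerHypothesis (V.conductorNorm ℤ) K := by
    intro ℓ hℓ hℓV
    have hℓV' : ℓ ∣ V.conductorNorm ℤ := by exact_mod_cast hℓV
    have hℓW : ℓ ∣ W.conductorNorm ℤ :=
      AdditiveBranchIMCMultLower.dvd_conductorNorm_of_dvd_conductorNorm_twist_model hp2 V W Cd hCd' hadd hℓ hℓV'
    have hℓp : ℓ ≠ p := by
      rintro rfl
      exact (V.dvd_conductorNorm_iff_not_hasGoodReductionAtPrime ℓ).mp hℓV' hVgood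
    exact hHeeg ℓ hℓ (by exact_mod_cast hℓW) hℓp
  have hsurjV : V.HasSurjectiveModNGaloisRep p := by
    have h := (GaloisImage.hasSurjectiveModNGaloisRep_pow_iff_of_model_twist V p hD0 ⟨Cd, hCd⟩ 1)
    rw [pow_one] at h
    exact h.mp hsurj
  haveI : NeZero (p : ℚ) := ⟨by exact_mod_cast hp.ne_zero⟩
  have hirrV : V.HasIrreducibleModPGaloisRep p := hasIrreducibleModPGaloisRep_of_hasSurjectiveModNGaloisRep V p hsurjV
  have hLV : V.entireLFunction 1 ≠ 0 := by
    haveI : (W.quadraticTwist (NumberField.discr K : ℚ)).IsElliptic := W.isElliptic_quadraticTwist hD0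
    have hVL : V.entireLFunction = (W.quadraticTwist (NumberField.discr K : ℚ)).entireLFunction := by
      rw [← hC', entireLFunction_smul]
    have hdq : (NumberField.discr K : ℚ) = -(p : ℚ) := by rw [hdisc]; push_cast; ring
    rw [hVL, hdq]; exact hLt
  have hμ : ¬ p ∣ Units.torsionOrder K := by
    rw [Literature.NumberTheory.QuadraticFields.Quadratic.torsionOrder_eq_two_of_discr_lt_neg_four hK.1
      (by rw [hdisc]; omega)]
    intro h
    exact hp2 ((Nat.prime_dvd_prime_iff_eq hp Nat.prime_two).mp h)
  obtain ⟨Dt, H, ι, P, hP, hc⟩ :=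
    X11b.exists_maninDatum_of_good hnf hMaz hNS V p (V.conductorNorm ℤ) K rfl hp2 hVgood hirrV hK hHN
  exact missingLowerBoundAt_of_selfTwistFrame_of_wuthrich hGZK hmod hW21 W p hp2 hr hsurj V (V.conductorNorm ℤ) K hK
    hdisc hμ Cd hCd hVgood hLV hHN (hGZ _ V K) (hKo _ V K) Dt H ι P hP hc
    (hL5 V p K W Cd Dt H ι P hp5 hVgood hLV hsurjV hK hdisc hHN hCd hr ⟨hp2, hadd, hG, he⟩ hP hc)

end Summit.BirchSwinnertonDyer.BirchSwinnertonDyer.Theorems.AdditiveBranchIMCGordTwoRankOne.HeegnerKolyvagin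

end
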